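import Literature.NumberTheory.EllipticCurves.DeligneSerreProp27Proofs
import HarnessLib

/-!
# Conjugates `σ(F)` of `Γ₁(N)`-cusp forms under `Aut(ℂ)`, granted Deligne–Serre (2.7.2)

Topic `NumberTheory/EllipticCurves`; a proofs-only file (theorems only, no definitions, no named
facts). Deligne–Serre 1974, Prop. 2.7, (2.7.2) — the tree's named fact
`DeligneSerre1974_span_integralLattice1 N k` (`NewformGaloisRepIntegralityProofs.lean`), taken
here as the hypothesis `hspan` on its conclusion `span_ℂ L = S_k(Γ₁(N))` — makes a `ℤ`-basis of
Deligne–Serre's lattice `L` (forms all of whose diamond twists have integral `q`-expansions) a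
`ℂ`-basis of `S_k(Γ₁(N))` (the tree's `integralBasis`, `DeligneSerreProp27Proofs.lean`). In this
basis a field automorphism `σ` of `ℂ` acts on coordinates, `σ(Σ cᵢ bᵢ) = Σ σ(cᵢ) bᵢ`, and this
file records the two properties of `σ(F)` used downstream (Deligne–Serre (2.7.4): "pour tout
automorphisme `σ` de `ℂ`, la forme `σ(f)` … a pour coefficients les `σ(aₙ)`"; Shimura 1971,
§3.5, the action of `Aut(ℂ)` on `q`-expansions):

* `exists_cuspForm_conj` — for every `F ∈ S_k(Γ₁(N))` there is `σ(F) ∈ S_k(Γ₁(N))` with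
  `aₙ(σ(F)) = σ(aₙ(F))` for all `n` **and** `aₙ(⟨d⟩ σ(F)) = σ(aₙ(⟨d⟩ F))` for all units `d` and
  all `n` (the diamond operators preserve `L`, `diamondOp_mem_integralLattice1`, hence have
  integer matrices in the basis, `exists_int_repr_integralBasis`); in particular
  (`diamondOp_conj_eq_self`) if `F` is fixed by all diamond operators — i.e. comes from
  `S_k(Γ₀(N))` — then so is `σ(F)`.
* Uniqueness and functoriality follow from the `q`-expansion principle
  (`cuspForm_gamma1_eq_zero_of_forall_cuspCoeff`): `cuspForm_eq_of_cuspCoeff_conj`.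

## References

* P. Deligne, J.-P. Serre, *Formes modulaires de poids 1*, Ann. Sci. ÉNS 7 (1974): Prop. 2.7,
  (2.7.2)–(2.7.4). [DeligneSerreASENS1974]
* G. Shimura, *Introduction to the arithmetic theory of automorphic functions*, 1971: §3.5,
  Thm. 3.52. [ShimuraIATAF1971]
-/

noncomputable section

open scoped MatrixGroups
open CongruenceSubgroup UpperHalfPlane Module

namespace Literature.NumberTheory.EllipticCurves.ModularForms

variable {N : ℕ} [NeZero N] {k : ℤ}

/-! ### Coefficients of coordinate-conjugated forms -/

/-- The basis vectors of `integralBasis` lie in Deligne–Serre's lattice `L`. [folklore] -/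
theorem integralBasis_mem
    (hspan : Submodule.span ℂ (integralLattice1 N k : Set (CuspForm (Gamma1 N) k)) = ⊤)
    (i : Module.Free.ChooseBasisIndex ℤ (integralLattice1 N k)) :
    integralBasis N k hspan i ∈ integralLattice1 N k := by
  rw [integralBasis, LatticeEigen.latticeBasis_apply]
  exact LatticeEigen.latticeVec_mem _ i

/-- The basis vectors of `integralBasis` have integer Fourier coefficients. [folklore] -/
theorem exists_int_cuspCoeff_integralBasis
    (hspan : Submodule.span ℂ (integralLattice1 N k : Set (CuspForm (Gamma1 N) k)) = ⊤)
    (i : Module.Free.ChooseBasisIndex ℤ (integralLattice1 N k)) (n : ℕ) :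
    ∃ z : ℤ, (z : ℂ) = cuspCoeff (integralBasis N k hspan i) n :=
  exists_int_eq_cuspCoeff_of_mem_integralLattice1 (integralBasis_mem hspan i) n

/-- The Fourier coefficients of the form with coordinates `y` in `integralBasis`:
`aₙ(Σ yᵢ bᵢ) = Σ yᵢ aₙ(bᵢ)`. [folklore] -/
theorem cuspCoeff_equivFun_symm
    (hspan : Submodule.span ℂ (integralLattice1 N k : Set (CuspForm (Gamma1 N) k)) = ⊤)
    (y : Module.Free.ChooseBasisIndex ℤ (integralLattice1 N k) → ℂ) (n : ℕ) :
    cuspCoeff ((integralBasis N k hspan).equivFun.symm y) n =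
      ∑ i, y i * cuspCoeff (integralBasis N k hspan i) n := by
  rw [Basis.equivFun_symm_apply,
    ← cuspCoeffₗ_apply (HeckeTGamma1.one_mem_strictPeriods_Gamma1 N) n, map_sum]
  refine Finset.sum_congr rfl fun i _ ↦ ?_
  rw [map_smul, smul_eq_mul, cuspCoeffₗ_apply]

/-- **Conjugating coordinates conjugates coefficients**: for a field automorphism `σ` of `ℂ`,
`aₙ(Σ σ(yᵢ) bᵢ) = σ(aₙ(Σ yᵢ bᵢ))`, because the `aₙ(bᵢ)` are integers. [cite: DeligneSerreASENS1974, Prop. 2.7 (2.7.4)] -/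
theorem cuspCoeff_equivFun_symm_conj
    (hspan : Submodule.span ℂ (integralLattice1 N k : Set (CuspForm (Gamma1 N) k)) = ⊤)
    (σ : ℂ ≃+* ℂ) (y : Module.Free.ChooseBasisIndex ℤ (integralLattice1 N k) → ℂ) (n : ℕ) :
    cuspCoeff ((integralBasis N k hspan).equivFun.symm (fun i ↦ σ (y i))) n =
      σ (cuspCoeff ((integralBasis N k hspan).equivFun.symm y) n) := by
  rw [cuspCoeff_equivFun_symm, cuspCoeff_equivFun_symm, map_sum]
  refine Finset.sum_congr rfl fun i _ ↦ ?_
  obtain ⟨z, hz⟩ := exists_int_cuspCoeff_integralBasis hspan i n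
  rw [← hz, map_mul, map_intCast]

/-! ### Diamond operators in the integral basis -/

/-- **Diamond operators commute with coordinate conjugation**: for a unit `d`,
`⟨d⟩(Σ σ(yᵢ) bᵢ)` has coordinates `σ` of the coordinates of `⟨d⟩(Σ yᵢ bᵢ)` — the matrix of
`⟨d⟩` in `integralBasis` is integral (`exists_int_repr_integralBasis`, since `⟨d⟩` preserves
`L`, `diamondOp_mem_integralLattice1`). [cite: DeligneSerreASENS1974, Prop. 2.7 (2.7.1)] -/
theorem equivFun_diamondOp_equivFun_symm_conj
    (hspan : Submodule.span ℂ (integralLattice1 N k : Set (CuspForm (Gamma1 N) k)) = ⊤)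
    (σ : ℂ ≃+* ℂ) (d : (ZMod N)ˣ)
    (y : Module.Free.ChooseBasisIndex ℤ (integralLattice1 N k) → ℂ)
    (l : Module.Free.ChooseBasisIndex ℤ (integralLattice1 N k)) :
    (integralBasis N k hspan).equivFun
        (diamondOp N k (d : ZMod N) ((integralBasis N k hspan).equivFun.symm fun i ↦ σ (y i))) l =
      σ ((integralBasis N k hspan).equivFun
        (diamondOp N k (d : ZMod N) ((integralBasis N k hspan).equivFun.symm y)) l) := by
  rw [LatticeEigen.equivFun_apply_equivFun_symm, LatticeEigen.equivFun_apply_equivFun_symm,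
    map_sum]
  refine Finset.sum_congr rfl fun i _ ↦ ?_
  obtain ⟨m, hm⟩ := exists_int_repr_integralBasis hspan (diamondOp N k (d : ZMod N))
    (fun x hx ↦ diamondOp_mem_integralLattice1 hx d) l i
  rw [hm, map_mul, map_intCast]

/-! ### The conjugate form -/

/-- **The conjugate `σ(F)` of a `Γ₁(N)`-cusp form** (granted Deligne–Serre (2.7.2), `hspan`):
for `F ∈ S_k(Γ₁(N))` and `σ ∈ Aut(ℂ)` there is `F' ∈ S_k(Γ₁(N))` with `aₙ(F') = σ(aₙ(F))` for
all `n`, and `aₙ(⟨d⟩F') = σ(aₙ(⟨d⟩F))` for all units `d` and all `n` — namely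
`F' = Σ σ(cᵢ) bᵢ` for `F = Σ cᵢ bᵢ` in `integralBasis` (Deligne–Serre (2.7.4): "la forme `σ(f)`
… a pour coefficients les `σ(aₙ)`"). [cite: DeligneSerreASENS1974, Prop. 2.7 (2.7.2)–(2.7.4)] -/
theorem exists_cuspForm_conj
    (hspan : Submodule.span ℂ (integralLattice1 N k : Set (CuspForm (Gamma1 N) k)) = ⊤)
    (σ : ℂ ≃+* ℂ) (F : CuspForm (Gamma1 N) k) :
    ∃ F' : CuspForm (Gamma1 N) k, (∀ n, cuspCoeff F' n = σ (cuspCoeff F n)) ∧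
      ∀ (d : (ZMod N)ˣ) (n : ℕ),
        cuspCoeff (diamondOp N k (d : ZMod N) F') n = σ (cuspCoeff (diamondOp N k (d : ZMod N) F) n) := by
  set b := integralBasis N k hspan with hb
  set y := b.equivFun F with hy
  have hF : F = b.equivFun.symm y := (b.equivFun.symm_apply_apply F).symm
  refine ⟨b.equivFun.symm fun i ↦ σ (y i), fun n ↦ ?_, fun d n ↦ ?_⟩
  · conv_rhs => rw [hF]
    exact cuspCoeff_equivFun_symm_conj hspan σ y n
  · -- coordinates of `⟨d⟩ F'` are `σ` of those of `⟨d⟩ F`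
    set w := b.equivFun (diamondOp N k (d : ZMod N) (b.equivFun.symm y)) with hw
    have h1 : diamondOp N k (d : ZMod N) (b.equivFun.symm fun i ↦ σ (y i)) =
        b.equivFun.symm fun l ↦ σ (w l) := by
      apply b.equivFun.injective
      rw [LinearEquiv.apply_symm_apply]
      funext l
      exact equivFun_diamondOp_equivFun_symm_conj hspan σ d y l
    have h2 : diamondOp N k (d : ZMod N) F = b.equivFun.symm w := by
      rw [hw, LinearEquiv.symm_apply_apply, ← hF]
    rw [h1, h2]
    exact cuspCoeff_equivFun_symm_conj hspan σ w n

/-- Two `Γ₁(N)`-cusp forms with the same Fourier coefficients are equal (the `q`-expansion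
principle, `cuspForm_gamma1_eq_zero_of_forall_cuspCoeff`). [folklore] -/
theorem cuspForm_gamma1_eq_of_forall_cuspCoeff {F G : CuspForm (Gamma1 N) k}
    (h : ∀ n, cuspCoeff F n = cuspCoeff G n) : F = G := by
  rw [← sub_eq_zero]
  refine cuspForm_gamma1_eq_zero_of_forall_cuspCoeff _ fun n ↦ ?_
  rw [← cuspCoeffₗ_apply (HeckeTGamma1.one_mem_strictPeriods_Gamma1 N) n, map_sub,
    cuspCoeffₗ_apply, cuspCoeffₗ_apply, h n, sub_self]

/-- **Conjugates of diamond-invariant forms are diamond-invariant**: if `⟨d⟩F = F` for a unit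
`d` and `F'` is a conjugate of `F` as in `exists_cuspForm_conj`, then `⟨d⟩F' = F'`. In
particular conjugation preserves the image of `S_k(Γ₀(N))` in `S_k(Γ₁(N))`.
[cite: DeligneSerreASENS1974, Prop. 2.7 (2.7.4)] -/
theorem diamondOp_conj_eq_self {σ : ℂ ≃+* ℂ} {F F' : CuspForm (Gamma1 N) k} {d : (ZMod N)ˣ}
    (hcoeff : ∀ n, cuspCoeff F' n = σ (cuspCoeff F n))
    (hdia : ∀ n, cuspCoeff (diamondOp N k (d : ZMod N) F') n =
      σ (cuspCoeff (diamondOp N k (d : ZMod N) F) n))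
    (hF : diamondOp N k (d : ZMod N) F = F) : diamondOp N k (d : ZMod N) F' = F' :=
  cuspForm_gamma1_eq_of_forall_cuspCoeff fun n ↦ by rw [hdia n, hF, hcoeff n]

/-- **Conjugation reflects linear relations**: if `F'`, `G'` are conjugates of `F`, `G` by `σ`
and `F' = e • G'`, then `F = σ⁻¹(e) • G` (compare coefficients). [folklore] -/
theorem eq_smul_of_conj_eq_smul {σ : ℂ ≃+* ℂ} {F F' G G' : CuspForm (Gamma1 N) k}
    (hF : ∀ n, cuspCoeff F' n = σ (cuspCoeff F n)) (hG : ∀ n, cuspCoeff G' n = σ (cuspCoeff G n))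
    {e : ℂ} (h : F' = e • G') : F = σ.symm e • G := by
  refine cuspForm_gamma1_eq_of_forall_cuspCoeff fun n ↦ ?_
  apply σ.injective
  have h1 : cuspCoeff F' n = e * cuspCoeff G' n := by
    rw [h, ← cuspCoeffₗ_apply (HeckeTGamma1.one_mem_strictPeriods_Gamma1 N) n, map_smul,
      smul_eq_mul, cuspCoeffₗ_apply]
  have h2 : cuspCoeff (σ.symm e • G) n = σ.symm e * cuspCoeff G n := by
    rw [← cuspCoeffₗ_apply (HeckeTGamma1.one_mem_strictPeriods_Gamma1 N) n, map_smul,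
      smul_eq_mul, cuspCoeffₗ_apply]
  rw [← hF n, h1, hG n, h2, map_mul, RingEquiv.apply_symm_apply]

/-- A conjugate of a nonzero form is nonzero. [folklore] -/
theorem ne_zero_of_conj {σ : ℂ ≃+* ℂ} {F F' : CuspForm (Gamma1 N) k}
    (hF : ∀ n, cuspCoeff F' n = σ (cuspCoeff F n)) (h0 : F ≠ 0) : F' ≠ 0 := by
  intro h
  apply h0
  refine cuspForm_gamma1_eq_zero_of_forall_cuspCoeff _ fun n ↦ ?_
  apply σ.injective
  rw [← hF n, h, map_zero]
  change (qExpansion 1 ⇑(0 : CuspForm (Gamma1 N) k)).coeff n = 0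
  simp [UpperHalfPlane.qExpansion_zero]

end Literature.NumberTheory.EllipticCurves.ModularForms

end
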